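import Summits.ValiantsHypothesis.ValiantsHypothesis.Theorems.PolyaContinuedLaplaceRigidityStrength
import Summits.ValiantsHypothesis.ValiantsHypothesis.Theorems.RigidityForcesSymmetryRankRigidMinimalReprLaplaceDefs
import Summits.ValiantsHypothesis.ValiantsHypothesis.Theses.PolyaContinued
import Summits.ValiantsHypothesis.ValiantsHypothesis.Theses.RigidityForcesSymmetry
import HarnessLib

/-!
# Sketch (val-idea-18, card `left-torus-rung`): the LEFT-TORUS-FIXED Laplace law and the row-face descent

Between the PROVED full-torus rung R2 of `Lines/laplace_rigidity.lean` (`torusFixedLaplaceRigidity`: row- AND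
column-weight vectors ⇒ `w ≥ C(n,k)`, a volume count symmetric in per/det) and the open rung `StrengthTwoPerFour`
(stmt-25160, no torus) sits the LEFT-torus-fixed law: factors that are weight vectors of the ROW torus only.
It is the first level at which per and det separate at (4,2): det₄ has a row-homogeneous (2,2)-decomposition of
width 3 (arXiv:2509.06294 Thm 3: `det A = u₁₂u₃₄ − u₁₃u₂₄ + u₁₄u₂₃`, `u_ij = Σ_J det A_{{i,j},J}` row-homogeneous),
per₄ has none of width 5 — from the landed `laplaceOptimal_four : LaplaceOptimal 4` (p597028) by coefficient
extraction (stub below, M-sized); in general `LaplaceOptimal n ⇒` the left-torus law at `n` for every `k`, so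
`LaplaceOptimalFive` (stmt-24813) is exactly the per-specific input of the n = 5 rung.
HONEST FRAMING: support rungs below `StrengthTwoPerFour`; `RowFaceDescent` is the card's located residual (proxy
statement); nothing of `CoverDecancellation` or VP ≠ VNP is asserted.
-/

set_option autoImplicit false
set_option linter.dupNamespace false

namespace Summit.ValiantsHypothesis.ValiantsHypothesis.Cruxes.CoverDecancellation.LeftTorusRung

open MvPolynomial
open Summit.ValiantsHypothesis.ValiantsHypothesis.Theorems.RigidityForcesSymmetryRankRigidMinimalRepr (LaplaceOptimal)

noncomputable section

/-- row-degree vector of a monomial (verbatim `rowDeg` of `Lines/laplace_rigidity.lean` l.500). -/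
def rowDeg {n : ℕ} (m : (Fin n × Fin n) →₀ ℕ) : Fin n → ℕ := fun i => ∑ j, m (i, j)

/-- `f` is a weight vector of the LEFT (row) torus `(ℂˣ)ⁿ`: all monomials share the row-degree vector
(compare `IsTorusWeightVector` ibid., which also fixes the column degrees). Vacuous for `f = 0`. -/
def IsRowWeightVector {n : ℕ} (f : MvPolynomial (Fin n × Fin n) ℂ) : Prop :=
  ∀ m ∈ f.support, ∀ m' ∈ f.support, rowDeg m = rowDeg m'

/-- verbatim copy of `…Cruxes.CoverDecancellation.LaplaceRigidity.IsTwoFactorDecomp` (workfiles are not importable). -/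
def IsTwoFactorDecomp (n k w : ℕ) (p q : Fin w → MvPolynomial (Fin n × Fin n) ℂ) : Prop :=
  (∀ i, (p i).IsHomogeneous k) ∧ (∀ i, (q i).IsHomogeneous (n - k)) ∧
    Literature.Computability.AlgebraicComplexity.perPoly (Fin n) ℂ = ∑ i, p i * q i

/-- **R2½ — left-torus-fixed Laplace rigidity at `n`**: every (k, n−k) two-factor decomposition of `per_n` whose
factors are ROW weight vectors has width `≥ C(n,k)`. -/
def LeftTorusFixedLaplaceRigidity (n : ℕ) : Prop :=
  ∀ k w : ℕ, 0 < k → k < n → ∀ p q : Fin w → MvPolynomial (Fin n × Fin n) ℂ,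
    (∀ i, IsRowWeightVector (p i)) → (∀ i, IsRowWeightVector (q i)) →
      IsTwoFactorDecomp n k w p q → n.choose k ≤ w

/-- FIRST LEMMA (stub, M-sized, provable now): `LaplaceOptimal n ⇒` the left-torus law at `n`.  Proof sketch: keep the
indices `t` whose `p t` has 0/1 row degrees (a `k`-set `R_t`) and whose `q t` has the complementary indicator; put
`S t := R_t`, `u t v := coeff (∑ r ∈ R_t, single (r, v r) 1) (p t)`, `w t v := coeff (∑ r ∉ R_t, single (r, v r) 1) (q t)`;
the dropped indices contribute nothing to the coefficient of the row-multilinear monomial `m_v`, which in `per_n` is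
`[v injective]` (`JerrumSnir.mem_support_perPoly`); `LaplaceOptimal n` gives `|T|·k!(n-k)! ≥ n!`. -/
theorem stub_leftTorusFixed_of_laplaceOptimal (n : ℕ) (h : LaplaceOptimal n) :
    LeftTorusFixedLaplaceRigidity n := by
  sorry

/-- The (4,2) instance: no row-homogeneous (2,2)-decomposition of `per₄` of width 5 (det₄: width 3 exists). PROVED from
the stub and the LANDED `laplaceOptimal_four` would make this unconditional; stated here against `LaplaceOptimal 4`. -/
theorem leftTorusFixedRungFourTwo (h4 : LaplaceOptimal 4) :
    ∀ p q : Fin 5 → MvPolynomial (Fin 4 × Fin 4) ℂ,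
      (∀ i, IsRowWeightVector (p i)) → (∀ i, IsRowWeightVector (q i)) → ¬ IsTwoFactorDecomp 4 2 5 p q := by
  intro p q hp hq h
  have := stub_leftTorusFixed_of_laplaceOptimal 4 h4 2 5 (by norm_num) (by norm_num) p q hp hq h
  simp [Nat.choose] at this

/-- The n = 5 instance is fed BY NAME by stmt-24813 (`LaplaceOptimalFive = LaplaceOptimal 5`): e.g. no row-homogeneous
(2,3)-decomposition of `per₅` of width 9. -/
theorem leftTorusFixedRungFiveTwo
    (h5 : Summit.ValiantsHypothesis.ValiantsHypothesis.Theses.RigidityForcesSymmetry.LaplaceOptimalFive) :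
    ∀ p q : Fin 9 → MvPolynomial (Fin 5 × Fin 5) ℂ,
      (∀ i, IsRowWeightVector (p i)) → (∀ i, IsRowWeightVector (q i)) → ¬ IsTwoFactorDecomp 5 2 9 p q := by
  intro p q hp hq h
  have := stub_leftTorusFixed_of_laplaceOptimal 5 h5 2 9 (by norm_num) (by norm_num) p q hp hq h
  simp [Nat.choose] at this

/-- ROW-FACE DESCENT at width `w` — PROXY form of the card's located residual (as an existence statement it is
vacuous/trivial wherever `StrengthTwoPerFour` is decided; the content is the re-pairing lemma on initial syzygies
described in the card). -/
def RowFaceDescent (w : ℕ) : Prop :=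
  ∀ p q : Fin w → MvPolynomial (Fin 4 × Fin 4) ℂ, IsTwoFactorDecomp 4 2 w p q →
    ∃ p' q' : Fin w → MvPolynomial (Fin 4 × Fin 4) ℂ,
      (∀ i, IsRowWeightVector (p' i)) ∧ (∀ i, IsRowWeightVector (q' i)) ∧ IsTwoFactorDecomp 4 2 w p' q'

/-- composition to the rung BY NAME (`Theses.PolyaContinued.StrengthTwoPerFour` = stmt-25160 = `RungFourTwo`). -/
theorem strengthTwoPerFour_of (h4 : LaplaceOptimal 4) (hd : RowFaceDescent 5) :
    Summit.ValiantsHypothesis.ValiantsHypothesis.Theses.PolyaContinued.StrengthTwoPerFour := by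
  intro p q hpq
  obtain ⟨p', q', hp', hq', h'⟩ := hd p q hpq
  exact leftTorusFixedRungFourTwo h4 p' q' hp' hq' h'

end

end Summit.ValiantsHypothesis.ValiantsHypothesis.Cruxes.CoverDecancellation.LeftTorusRung
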